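import Summits.ResolutionOfSingularities.ResolutionOfSingularities.Theorems.UniversalCellsCampaignW82FamilyResolutionInsep
import Summits.ResolutionOfSingularities.ResolutionOfSingularities.Theorems.UniformComplexityCampaignW82FamilyResolutionOneFibre
import HarnessLib

/-!
# [OURS · L1 W8.2] RESOLUTION IN FAMILIES WITH PURELY INSEPARABLE BASE EXTENSIONS, «ONE CLOSED FIBRE»
# FORM — campaign statements (door 1, `UniversalCells` / `PrimeFieldToPerfect`), Theses-free module

Cell `res-hironaka` (run/shared/lean/pub/res-hironaka/), LADDER-RESOLUTION rung L (RESCUE), slot W8.2 of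
plan/RESCUE-SEED.md («PRIME-FIELD / UNIVERSALITY TRANSFER instead of descent: resolve over 𝔽_p or 𝔽̄_p and
transfer FAMILIES»). FIRST DOOR: route `UniversalCells`, item `PrimeFieldToPerfect`
(stmt-ResolutionOfSingularities-15233: resolution over `Spec (ZMod p)` ⇒ resolution over every PERFECT field
of characteristic `p`). Sequel of the gen-5 door-1 module
`Theorems/UniversalCellsCampaignW82FamilyResolutionInsep.lean` (p533235: `FamilyResolutionInsep p k` —
RADICIAL base extensions, all field-valued fibres weakly resolved; `PerfectRes p ↔ FamilyResolutionInsep p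
(ZMod p)`, p535806) and of the gen-6 door-2 module `…CampaignW82FamilyResolutionOneFibre.lean` (p540376:
the one-closed-fibre forms for algebraic base extensions). Self-typed by res-L1-s82-pv-2 (gen 6) under the
rung-B precedent; NOTHING is proved about resolution of singularities here: two `def`s, two anchors.

WHY THIS FILE. Door 1's family form with the E7 economy of door 2 (EGA IV₃ 12.2.4 (iii), tree lemma
`Morphisms.exists_smooth_morphismRestrict_of_smooth_fiber`): after a RADICIAL finite-type base extension
`A → A'`, a proper modification of the family, FLAT along ONE CLOSED fibre — for `k = 𝔽_p`: a variety over
a FINITE FIELD — with that fibre smooth and an isomorphism over an open meeting it. Two statements: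

* `SmoothFamilyResolutionInsep p k` — strong form: radicial `A → A'`, `G` proper, `𝒴 → Spec A'` SMOOTH,
  `G` an isomorphism over an open `W` meeting every fibre;
* `FamilyResolutionInsepOneFibre p k` — one-closed-fibre form: radicial `A → A'`, `G` proper, an
  isomorphism over `W` meeting the fibre over ONE closed `s`, `𝒴 → Spec A'` flat at the points over `s`,
  fibre over `s` smooth over `κ(s)` (a finite extension of `k`; a finite field when `k = 𝔽_p`).

The hypothesis on the family is that of `FamilyResolutionInsep p k` verbatim (proper; RADICIAL GENERIC
FIBRE `𝒳 ×_A Spec L` integral for some perfect `L` radicial over `A`). Prover's theorems (gen 6, sibling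
files): resolution over all perfect fields of characteristic `p` `→ SmoothFamilyResolutionInsep p k → `
(`FamilyResolutionInsep p k` and) `FamilyResolutionInsepOneFibre p k →` resolution over every PERFECT
`K ⊇ k` of characteristic `p` (the `K`-point lifts along the radicial `A'` because `K` is perfect —
`PerfectRing.lift`, gen 5's `exists_ringHom_comp_eq_of_radicial` — injectively, hence to the generic point,
which lies in the open over which `𝒴` is smooth by EGA IV₃ 12.2.4 (iii)); hence
`Theses.UniversalCells.PrimeFieldToPerfect ↔ ∀ p, PrimeFieldRes p → FamilyResolutionInsepOneFibre p (ZMod p)`.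

BUILD RULE (cell, director-resolution 2026-08-26T18:53:29Z (B)): OURS vocabulary file, THESES-FREE BY BIRTH —
imports only the Theses-free gen-5/gen-6 vocabulary modules and `HarnessLib`.

HONEST FRAMING. The `def`s below are OURS — campaign statements that REPLACE THE ROLE of a printed item of
H. Hironaka's manuscript *Resolution of singularities in positive characteristics* (2017-03-23,
[Hironaka2017], lit key `paper:url-3343fd9e678b`) — namely §17 ¶2, p.89 l.59–62 («In this work the base
field K is always assumed to be a finite field or Z/pZ because our resolution is for all dimension. When the
K has transcendence degree d we can reformulate the resolution problem to the case of dimension d + dim Z»;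
typed AS PRINTED, not asserted, as `S17Methodology.U89_2` / `U89_3`): the reformulation of a variety over a
PERFECT field as a family over the prime field returns a resolution exactly when — the statements below —
ONE closed fibre of the family (a variety over a finite field) can be resolved FLATLY inside a proper
modification of the radicially base-extended family; NOT a statement of the manuscript. Barrier bookkeeping
(`RegularNotGeometricallyRegular.lean`, `InseparableBaseChangeResolution.lean`,
`FrobeniusTwistResolution.lean`): the radicial `A → A'` IS the inseparable base change along which regularity
is not stable; flatness + one smooth closed fibre is what a resolution of the (regular) total space does not
give. Hironaka's statements are CANDIDATES under adjudication (D-0012/D-0089); nothing here is attributed to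
the author and no verdict on the manuscript is implied. AI typing, weaker than expert review.

VACUITY SELF-CHECK (`p` prime, `k` of characteristic `p`): neither statement is trivially true (at `A = k`
perfect: resolution of the given integral proper `k`-scheme, open in dimension `≥ 4`); neither is trivially
false (both follow from resolution over all perfect fields of characteristic `p` by the prover's strong
spreading theorem with embedding); the flatness clause of the one-fibre form is the EGA IV₃ 12.2.4 (iii)
hypothesis consumed by the prover's E7 argument (no claim about the flatness-free variant). Composite `p`:
not intended.

## References (vocabulary and locators only; nothing cited as a premise)
* H. Hironaka, ms. 2017-03-23, §17 ¶2 p.89 l.59–62 — under adjudication, quoted for the role replaced, not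
  asserted. [Hironaka2017]
* A. Grothendieck, J. Dieudonné, EGA IV₃ (1966) Thm. 12.2.4 (iii); EGA IV₄ (1967) Thm. 17.5.1. [EGAIV3]
* The Stacks Project, Tags 01V8, 01VA. [StacksProject]
* Tree: `Summits/…/Cruxes/PrimeFieldToPerfect/KERNEL-c3.md` §1, (5.1), (5.5) — cell file, OURS.
-/

noncomputable section

set_option linter.dupNamespace false -- mandated namespace of this single-conjunct summit

open _root_.CategoryTheory _root_.CategoryTheory.Limits _root_.AlgebraicGeometry
open Literature.AlgebraicGeometry.Resolution

namespace Summit.ResolutionOfSingularities.ResolutionOfSingularities.Theorems.CampaignW82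

/-! ## The strong radicial family form -/

/-- [OURS · L1 W8.2 door 1] replaces the role of §17 ¶2, p.89 l.59–62 (the variety over a perfect field as a
family over the prime field; `S17Methodology.U89_3`) by the STRONG form of what such a reformulation must
deliver over PERFECT target fields; NOT a statement of the manuscript. **SMOOTH RESOLUTION IN FAMILIES WITH
RADICIAL BASE EXTENSION, over `k`, exponent prime `p`.** For every finitely generated `k`-domain `A` and
every PROPER `f : 𝒳 → Spec A` whose RADICIAL GENERIC FIBRE `𝒳 ×_A Spec L` is integral for some perfect field
`L` with injective structure map `A → L` such that every `x : L` satisfies `b · x ^ (p ^ n) = a` for some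
`a, b ∈ A`, `b ≠ 0` (a perfect closure of `Frac A`), there exist a domain `A'` with an INJECTIVE,
FINITE-TYPE, RADICIAL (same clause) `A`-algebra structure, a scheme `𝒴`, `G : 𝒴 → 𝒳' := 𝒳 ×_A Spec A'`
and an open `W ⊆ 𝒳'` with: `G` PROPER; `𝒴 → Spec A'` SMOOTH; `G` an ISOMORPHISM over `W`; `W` meets EVERY
fibre of `𝒳' → Spec A'`. Prover's theorems (gen 6): ⇐ resolution over all perfect fields of characteristic
`p` (strong spreading with embedding `A' ↪ L`); ⇒ `FamilyResolutionInsep p k` and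
`FamilyResolutionInsepOneFibre p k`. Vacuity (`k` of characteristic `p`): not trivially true (at `A = k`
perfect: resolution of the given scheme); not trivially false (⇐ `PerfectRes p`). [folklore] -/
def SmoothFamilyResolutionInsep (p : ℕ) (k : Type) [Field k] : Prop :=
  ∀ (A : Type) [CommRing A] [IsDomain A] [Algebra k A], Algebra.FiniteType k A →
    ∀ (𝒳 : Scheme.{0}) (f : 𝒳 ⟶ Spec (.of A)), IsProper f →
      (∃ (L : Type) (_ : Field L) (_ : PerfectField L) (_ : Algebra A L),
          Function.Injective (algebraMap A L) ∧
          (∀ x : L, ∃ (n : ℕ) (a b : A), b ≠ 0 ∧ algebraMap A L b * x ^ p ^ n = algebraMap A L a) ∧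
          IsIntegral (pullback f (Spec.map (CommRingCat.ofHom (algebraMap A L))))) →
      ∃ (A' : Type) (_ : CommRing A') (_ : IsDomain A') (_ : Algebra A A'),
        Function.Injective (algebraMap A A') ∧ Algebra.FiniteType A A' ∧
        (∀ x : A', ∃ (n : ℕ) (a b : A), b ≠ 0 ∧ algebraMap A A' b * x ^ p ^ n = algebraMap A A' a) ∧
        ∃ (𝒴 : Scheme.{0})
          (G : 𝒴 ⟶ pullback f (Spec.map (CommRingCat.ofHom (algebraMap A A'))))
          (W : (pullback f (Spec.map (CommRingCat.ofHom (algebraMap A A')))).Opens),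
          IsProper G ∧
          Smooth (G ≫ pullback.snd f (Spec.map (CommRingCat.ofHom (algebraMap A A')))) ∧
          IsIso (G ∣_ W) ∧
          ∀ s : ↥(Spec (.of A')), ∃ x : ↥(pullback f (Spec.map (CommRingCat.ofHom (algebraMap A A')))),
            x ∈ W ∧ (pullback.snd f (Spec.map (CommRingCat.ofHom (algebraMap A A')))) x = s

/-- Anchor (pure logic): unpack the strong radicial family datum. [folklore] -/
theorem SmoothFamilyResolutionInsep.exists_datum {p : ℕ} {k : Type} [Field k]
    (h : SmoothFamilyResolutionInsep p k)
    (A : Type) [CommRing A] [IsDomain A] [Algebra k A] [Algebra.FiniteType k A]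
    (𝒳 : Scheme.{0}) (f : 𝒳 ⟶ Spec (.of A)) [IsProper f]
    (L : Type) [Field L] [PerfectField L] [Algebra A L] (hAL : Function.Injective (algebraMap A L))
    (hrad : ∀ x : L, ∃ (n : ℕ) (a b : A), b ≠ 0 ∧ algebraMap A L b * x ^ p ^ n = algebraMap A L a)
    (hint : IsIntegral (pullback f (Spec.map (CommRingCat.ofHom (algebraMap A L))))) :
    ∃ (A' : Type) (_ : CommRing A') (_ : IsDomain A') (_ : Algebra A A'),
      Function.Injective (algebraMap A A') ∧ Algebra.FiniteType A A' ∧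
      (∀ x : A', ∃ (n : ℕ) (a b : A), b ≠ 0 ∧ algebraMap A A' b * x ^ p ^ n = algebraMap A A' a) ∧
      ∃ (𝒴 : Scheme.{0})
        (G : 𝒴 ⟶ pullback f (Spec.map (CommRingCat.ofHom (algebraMap A A'))))
        (W : (pullback f (Spec.map (CommRingCat.ofHom (algebraMap A A')))).Opens),
        IsProper G ∧
        Smooth (G ≫ pullback.snd f (Spec.map (CommRingCat.ofHom (algebraMap A A')))) ∧
        IsIso (G ∣_ W) ∧
        ∀ s : ↥(Spec (.of A')), ∃ x : ↥(pullback f (Spec.map (CommRingCat.ofHom (algebraMap A A')))),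
          x ∈ W ∧ (pullback.snd f (Spec.map (CommRingCat.ofHom (algebraMap A A')))) x = s :=
  h A ‹_› 𝒳 f ‹_› ⟨L, ‹_›, ‹_›, ‹_›, hAL, hrad, hint⟩

/-! ## The one-closed-fibre radicial family form -/

/-- [OURS · L1 W8.2 door 1] replaces the role of §17 ¶2, p.89 l.59–62 (the variety over a perfect field as a
family over the prime field; `S17Methodology.U89_3`) by the WEAKEST form of what must be done to such a
family — ONE closed fibre, i.e. ONE variety over a finite extension of `k` (a FINITE FIELD when `k = 𝔽_p`);
NOT a statement of the manuscript. **RESOLUTION IN FAMILIES WITH RADICIAL BASE EXTENSION, ONE-CLOSED-FIBRE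
FORM, over `k`, exponent prime `p`.** For every finitely generated `k`-domain `A` and every PROPER
`f : 𝒳 → Spec A` whose radicial generic fibre is integral (as in `FamilyResolutionInsep p k`, p533235),
there exist a domain `A'` with an INJECTIVE, FINITE-TYPE, RADICIAL `A`-algebra structure (every `x : A'`
has `b · x ^ (p ^ n) = a`, `a, b ∈ A`, `b ≠ 0`), a scheme `𝒴`, `G : 𝒴 → 𝒳' := 𝒳 ×_A Spec A'`, an open
`W ⊆ 𝒳'` and a CLOSED point `s` of `Spec A'` such that: `G` is PROPER; `G` restricts to an ISOMORPHISM over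
`W`; `W` meets the fibre of `𝒳'` over `s`; `q : 𝒴 → 𝒳' → Spec A'` is FLAT AT THE POINTS OVER `s`; and the
fibre `q⁻¹(s) → Spec κ(s)` is SMOOTH. Prover's theorem (gen 6, E7 direction):
`FamilyResolutionInsepOneFibre p k →` resolution over every PERFECT `K ⊇ k` of characteristic `p` — `q` is
smooth over an open `V ∋ s` (EGA IV₃ 12.2.4 (iii)); the `K`-point of a `K`-variety spread over a finitely
generated `k`-subalgebra `R ⊆ K` lifts along the radicial `R → A'` (`K` perfect) INJECTIVELY, i.e. to the
generic point `∈ V`; the `K`-fibre of `G` is then a weak resolution. Conversely ⇐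
`SmoothFamilyResolutionInsep p k` (any closed point). Barrier bookkeeping as in the module docstring.
Vacuity (`k` of characteristic `p`): not trivially true (at `A = k` perfect: resolution of the given
scheme); not trivially false (⇐ `SmoothFamilyResolutionInsep p k` ⇐ `PerfectRes p`); the flatness clause is
the EGA IV₃ 12.2.4 (iii) hypothesis used by the prover (no claim about the variant without it).
[folklore] -/
def FamilyResolutionInsepOneFibre (p : ℕ) (k : Type) [Field k] : Prop :=
  ∀ (A : Type) [CommRing A] [IsDomain A] [Algebra k A], Algebra.FiniteType k A →
    ∀ (𝒳 : Scheme.{0}) (f : 𝒳 ⟶ Spec (.of A)), IsProper f →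
      (∃ (L : Type) (_ : Field L) (_ : PerfectField L) (_ : Algebra A L),
          Function.Injective (algebraMap A L) ∧
          (∀ x : L, ∃ (n : ℕ) (a b : A), b ≠ 0 ∧ algebraMap A L b * x ^ p ^ n = algebraMap A L a) ∧
          IsIntegral (pullback f (Spec.map (CommRingCat.ofHom (algebraMap A L))))) →
      ∃ (A' : Type) (_ : CommRing A') (_ : IsDomain A') (_ : Algebra A A'),
        Function.Injective (algebraMap A A') ∧ Algebra.FiniteType A A' ∧
        (∀ x : A', ∃ (n : ℕ) (a b : A), b ≠ 0 ∧ algebraMap A A' b * x ^ p ^ n = algebraMap A A' a) ∧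
        ∃ (𝒴 : Scheme.{0})
          (G : 𝒴 ⟶ pullback f (Spec.map (CommRingCat.ofHom (algebraMap A A'))))
          (W : (pullback f (Spec.map (CommRingCat.ofHom (algebraMap A A')))).Opens)
          (s : ↥(Spec (.of A'))),
          IsClosed ({s} : Set ↥(Spec (.of A'))) ∧
          IsProper G ∧
          IsIso (G ∣_ W) ∧
          (∃ x : ↥(pullback f (Spec.map (CommRingCat.ofHom (algebraMap A A')))),
            x ∈ W ∧ (pullback.snd f (Spec.map (CommRingCat.ofHom (algebraMap A A')))) x = s) ∧
          (∀ y : ↥𝒴, (G ≫ pullback.snd f (Spec.map (CommRingCat.ofHom (algebraMap A A')))) y = s →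
            ((G ≫ pullback.snd f (Spec.map (CommRingCat.ofHom (algebraMap A A')))).stalkMap y).hom.Flat) ∧
          Smooth ((G ≫ pullback.snd f (Spec.map (CommRingCat.ofHom (algebraMap A A')))).fiberToSpecResidueField s)

/-- Anchor (pure logic): unpack the one-closed-fibre radicial family datum. [folklore] -/
theorem FamilyResolutionInsepOneFibre.exists_datum {p : ℕ} {k : Type} [Field k]
    (h : FamilyResolutionInsepOneFibre p k)
    (A : Type) [CommRing A] [IsDomain A] [Algebra k A] [Algebra.FiniteType k A]
    (𝒳 : Scheme.{0}) (f : 𝒳 ⟶ Spec (.of A)) [IsProper f]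
    (L : Type) [Field L] [PerfectField L] [Algebra A L] (hAL : Function.Injective (algebraMap A L))
    (hrad : ∀ x : L, ∃ (n : ℕ) (a b : A), b ≠ 0 ∧ algebraMap A L b * x ^ p ^ n = algebraMap A L a)
    (hint : IsIntegral (pullback f (Spec.map (CommRingCat.ofHom (algebraMap A L))))) :
    ∃ (A' : Type) (_ : CommRing A') (_ : IsDomain A') (_ : Algebra A A'),
      Function.Injective (algebraMap A A') ∧ Algebra.FiniteType A A' ∧
      (∀ x : A', ∃ (n : ℕ) (a b : A), b ≠ 0 ∧ algebraMap A A' b * x ^ p ^ n = algebraMap A A' a) ∧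
      ∃ (𝒴 : Scheme.{0})
        (G : 𝒴 ⟶ pullback f (Spec.map (CommRingCat.ofHom (algebraMap A A'))))
        (W : (pullback f (Spec.map (CommRingCat.ofHom (algebraMap A A')))).Opens)
        (s : ↥(Spec (.of A'))),
        IsClosed ({s} : Set ↥(Spec (.of A'))) ∧
        IsProper G ∧
        IsIso (G ∣_ W) ∧
        (∃ x : ↥(pullback f (Spec.map (CommRingCat.ofHom (algebraMap A A')))),
          x ∈ W ∧ (pullback.snd f (Spec.map (CommRingCat.ofHom (algebraMap A A')))) x = s) ∧
        (∀ y : ↥𝒴, (G ≫ pullback.snd f (Spec.map (CommRingCat.ofHom (algebraMap A A')))) y = s →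
          ((G ≫ pullback.snd f (Spec.map (CommRingCat.ofHom (algebraMap A A')))).stalkMap y).hom.Flat) ∧
        Smooth ((G ≫ pullback.snd f (Spec.map (CommRingCat.ofHom (algebraMap A A')))).fiberToSpecResidueField s) :=
  h A ‹_› 𝒳 f ‹_› ⟨L, ‹_›, ‹_›, ‹_›, hAL, hrad, hint⟩

end Summit.ResolutionOfSingularities.ResolutionOfSingularities.Theorems.CampaignW82

end
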